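import Literature.Computability.Complexity.IrreducibilityLLLBerlekampMatrix
import Mathlib.Algebra.Polynomial.FieldDivision
import HarnessLib

/-!
# Berlekamp's algorithm on coefficient lists: one irreducible factor modulo `p` (LLL 1982, (3.1))

Support file for the discharge of the named fact
`Literature.Computability.Complexity.lll_monicIrreducible_mem_P` (irreducibility of monic integer
polynomials is decidable in `P`; Lenstra–Lenstra–Lovász 1982, §3). Step (3.1) of LLL82: "we
apply Berlekamp's algorithm … to find the complete factorization of `(f mod p)`"; the irreducibility
test only needs ONE monic irreducible factor `h mod p`. This file assembles it from the null
vector of Berlekamp's matrix (`berlekampVec`, `IrreducibilityLLLBerlekampMatrix.lean`) and the gcd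
modulo `p` (`pgcd`, `IrreducibilityLLLGcd.lean`):

* `splitCand p W v s = gcd(W, v - s)`, `findSplit` — the first `s ∈ {0, …, p-1}` giving a proper
  factor (Knuth §4.6.2, step B4: "calculate `gcd(u, v - s)` for `0 ≤ s < p`");
* `berlStep` — one refinement of the current factor `W` of `f mod p`: keep `W` if it is linear or
  Berlekamp's system has no nonconstant solution (then `W̄` is irreducible), else replace it by a
  proper factor; `berlekampFactor p f` — `|f|` refinements from `W = f`;
* **`berlekampFactor_spec`** (`p` prime, `f` normal monic squarefree modulo `p`, `deg ≥ 1`): the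
  output `u` is normal, `ū` is monic irreducible, `ū ∣ f̄`, `2 ≤ |u| ≤ |f|`.

## References

* D. E. Knuth, *The Art of Computer Programming*, Vol. 2, 3rd ed., 1998, §4.6.2, Algorithm B
  (steps B2–B4). [KnuthTAOCP2]
* A. K. Lenstra, H. W. Lenstra Jr., L. Lovász, Math. Ann. 261 (1982), §3, (3.1) and proof of (3.6).
  [LenstraLenstraLovasz1982]
-/

noncomputable section

namespace Literature.Computability.Complexity

open Polynomial SumcheckMA

namespace LLLFactoring

/-! ### The program -/

/-- The candidate factor `gcd(W, v - s)` modulo `p`. [cite: KnuthTAOCP2, §4.6.2, step B4] -/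
def splitCand (p : ℕ) (W v : List ℤ) (s : ℕ) : List ℤ := pgcd p W (psub v [(s : ℤ)])

/-- The first proper candidate (`2 ≤ |g| < |W|`), or `W` if there is none. [cite: KnuthTAOCP2, §4.6.2, step B4] -/
def findSplit (p : ℕ) (W v : List ℤ) : List ℤ :=
  (((List.range p).map (splitCand p W v)).find? fun g => decide (2 ≤ g.length ∧ g.length < W.length)).getD W

/-- One refinement of the current factor. [cite: KnuthTAOCP2, §4.6.2, Algorithm B] -/
def berlStep (p : ℕ) (W : List ℤ) : List ℤ :=
  if W.length < 3 then W else
    match berlekampVec p W with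
    | none => W
    | some v => findSplit p W v

/-- **One monic irreducible factor of `f mod p`** by `|f|` refinements of Berlekamp's splitting.
[cite: KnuthTAOCP2, §4.6.2, Algorithm B] [cite: LenstraLenstraLovasz1982, (3.1)] -/
def berlekampFactor (p : ℕ) (f : List ℤ) : List ℤ := (List.replicate f.length ()).foldl (fun W _ => berlStep p W) f

section Spec

variable {p : ℕ} [hp : Fact p.Prime]

/-- The invariant of the refinement loop: `W` is a normal list whose polynomial is a monic factor
of `f̄` of degree `|W| - 1 ≥ 1`, not longer than `f`. [folklore] -/
def BInv (p : ℕ) (f W : List ℤ) : Prop :=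
  Normal p W ∧ (toZMod p W).Monic ∧ (toZMod p W).natDegree = W.length - 1 ∧ 2 ≤ W.length ∧
    W.length ≤ f.length ∧ toZMod p W ∣ toZMod p f

/-- `toZMod` of a one-entry list. [folklore] -/
theorem toZMod_singleton (c : ℤ) : toZMod p [c] = C ((c : ℤ) : ZMod p) := by
  rw [toZMod_cons, toZMod_nil, mul_zero, add_zero]

/-- **The splitting step succeeds.** Under the invariant with `|W| ≥ 3`, for the vector `v` of
`berlekampVec`, `findSplit` returns a normal `g` with `ḡ` monic of degree `|g| - 1`, `ḡ ∣ W̄`, and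
`2 ≤ |g| < |W|`. [cite: KnuthTAOCP2, §4.6.2, step B4] -/
theorem findSplit_spec {f W v : List ℤ} (hW : BInv p f W) (h3 : 3 ≤ W.length) (hv : berlekampVec p W = some v) :
    Normal p (findSplit p W v) ∧ (toZMod p (findSplit p W v)).Monic ∧
      (toZMod p (findSplit p W v)).natDegree = (findSplit p W v).length - 1 ∧
      toZMod p (findSplit p W v) ∣ toZMod p W ∧ 2 ≤ (findSplit p W v).length ∧ (findSplit p W v).length < W.length := by
  classical
  obtain ⟨hWn, hWm, hWd, hW2, -, -⟩ := hW
  obtain ⟨hvn, hvpos, hvlt, -, hvdvd⟩ := berlekampVec_sound hWm hWd h3 hv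
  have hdvd' : toZMod p W ∣ toZMod p v ^ Fintype.card (ZMod p) - toZMod p v := by rwa [ZMod.card]
  obtain ⟨s, hs1, hs2⟩ := exists_natDegree_gcd_sub_C hdvd' hvpos hvlt
  have hW0 : toZMod p W ≠ 0 := hWm.ne_zero
  -- the candidate for `s.val` is proper
  set g₀ := splitCand p W v s.val with hg₀
  have hsubZ : ∀ t : ℕ, toZMod p (psub v [(t : ℤ)]) = toZMod p v - C ((t : ℕ) : ZMod p) := fun t => by
    rw [toZMod_psub, toZMod_singleton, Int.cast_natCast]
  have hg₀Z : toZMod p (psub v [(s.val : ℤ)]) = toZMod p v - C s := by rw [hsubZ, ZMod.natCast_zmod_val]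
  have hdeg₀ : (gcd (toZMod p W) (toZMod p v - C s)).natDegree = g₀.length - 1 := by
    rw [← hg₀Z]
    exact natDegree_gcd_eq fun h => hW0 h.1
  have hpred₀ : 2 ≤ g₀.length ∧ g₀.length < W.length := by
    rw [hdeg₀] at hs1 hs2; rw [hWd] at hs2; omega
  have hmem₀ : g₀ ∈ (List.range p).map (splitCand p W v) :=
    List.mem_map.2 ⟨s.val, List.mem_range.2 (ZMod.val_lt s), rfl⟩
  cases hfind : ((List.range p).map (splitCand p W v)).find? (fun g => decide (2 ≤ g.length ∧ g.length < W.length)) with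
  | none =>
    exfalso
    have := List.find?_eq_none.1 hfind g₀ hmem₀
    simp [hpred₀] at this
  | some g =>
    have hfs : findSplit p W v = g := by rw [findSplit, hfind]; rfl
    have hpred := List.find?_some hfind
    have hmem := List.mem_of_find?_eq_some hfind
    obtain ⟨s', -, rfl⟩ := List.mem_map.1 hmem
    simp only [decide_eq_true_eq] at hpred
    rw [hfs]
    obtain ⟨-, hda, -, hng, -, -, -, hmon⟩ := pxgcd_spec (p := p) W (psub v [(s' : ℤ)])
    have hne : (pxgcd p W (psub v [(s' : ℤ)])).1 ≠ [] := by
      intro h0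
      have := hpred.1
      rw [splitCand, pgcd, h0] at this
      simp at this
    obtain ⟨hm, hd⟩ := hmon hne
    exact ⟨hng, hm, hd, hda, hpred.1, hpred.2⟩

/-- **One refinement step**: the invariant is kept, the length does not increase, a fixed point is
an irreducible `W̄`, and otherwise the length drops. (`f̄` squarefree.)
[cite: KnuthTAOCP2, §4.6.2, Algorithm B] -/
theorem berlStep_spec {f W : List ℤ} (hsqf : Squarefree (toZMod p f)) (hW : BInv p f W) :
    BInv p f (berlStep p W) ∧ (berlStep p W).length ≤ W.length ∧
      (berlStep p W = W → Irreducible (toZMod p W)) ∧ (berlStep p W ≠ W → (berlStep p W).length < W.length) := by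
  obtain ⟨hWn, hWm, hWd, hW2, hWf, hWdvd⟩ := hW
  by_cases h3 : W.length < 3
  · have hres : berlStep p W = W := by rw [berlStep, if_pos h3]
    rw [hres]
    refine ⟨⟨hWn, hWm, hWd, hW2, hWf, hWdvd⟩, le_rfl, fun _ => ?_, fun h => absurd rfl h⟩
    have hdeg1 : (toZMod p W).degree = 1 := by
      rw [degree_eq_natDegree hWm.ne_zero, hWd]
      have : W.length - 1 = 1 := by omega
      rw [this]; rfl
    exact irreducible_of_degree_eq_one hdeg1
  · push Not at h3
    cases hv : berlekampVec p W with
    | none =>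
      have hres : berlStep p W = W := by rw [berlStep, if_neg (by omega), hv]
      rw [hres]
      refine ⟨⟨hWn, hWm, hWd, hW2, hWf, hWdvd⟩, le_rfl, fun _ => ?_, fun h => absurd rfl h⟩
      by_contra hirr
      have hsqW : Squarefree (toZMod p W) := hsqf.squarefree_of_dvd hWdvd
      have := berlekampVec_isSome_of_not_irreducible hWm hWd h3 hsqW hirr
      rw [hv] at this
      simp at this
    | some v =>
      have hres : berlStep p W = findSplit p W v := by rw [berlStep, if_neg (by omega), hv]
      rw [hres]
      obtain ⟨hgn, hgm, hgd, hgdvd, hg2, hglt⟩ := findSplit_spec ⟨hWn, hWm, hWd, hW2, hWf, hWdvd⟩ h3 hv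
      refine ⟨⟨hgn, hgm, hgd, hg2, by omega, hgdvd.trans hWdvd⟩, hglt.le, fun heq => ?_, fun _ => hglt⟩
      rw [heq] at hglt
      exact absurd hglt (lt_irrefl _)

/-- The run of the refinement loop. [folklore] -/
def berlRun (p : ℕ) (f : List ℤ) (k : ℕ) : List ℤ := (List.replicate k ()).foldl (fun W _ => berlStep p W) f

omit hp in
/-- Unfolding the run. [folklore] -/
theorem berlRun_succ (f : List ℤ) (k : ℕ) : berlRun p f (k + 1) = berlStep p (berlRun p f k) := by
  rw [berlRun, List.replicate_succ', List.foldl_append, List.foldl_cons, List.foldl_nil, ← berlRun]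

/-- **The run**: the invariant holds throughout, and after `k` steps either the current factor is a
fixed point or its length plus `k` is at most `|f|`. [cite: KnuthTAOCP2, §4.6.2, Algorithm B] -/
theorem berlRun_spec {f : List ℤ} (hsqf : Squarefree (toZMod p f)) (hf : BInv p f f) : ∀ k : ℕ,
    BInv p f (berlRun p f k) ∧ (berlStep p (berlRun p f k) = berlRun p f k ∨ (berlRun p f k).length + k ≤ f.length)
  | 0 => ⟨hf, Or.inr (by simp [berlRun])⟩
  | k + 1 => by
    obtain ⟨hinv, hor⟩ := berlRun_spec hsqf hf k
    obtain ⟨hinv', -, -, hlt⟩ := berlStep_spec hsqf hinv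
    rw [berlRun_succ]
    refine ⟨hinv', ?_⟩
    by_cases hfix : berlStep p (berlRun p f k) = berlRun p f k
    · left; rw [hfix, hfix]
    · right
      have h1 := hlt hfix
      rcases hor with h | h
      · exact absurd h hfix
      · omega

/-- **Berlekamp's algorithm finds a monic irreducible factor modulo `p`.** For `p` prime and `f` a
normal list whose polynomial `f̄ ∈ 𝔽_p[X]` is monic of degree `|f| - 1 ≥ 1` and squarefree, the
output `u = berlekampFactor p f` is normal, `ū` is monic of degree `|u| - 1`, irreducible, divides
`f̄`, and `2 ≤ |u| ≤ |f|`. [cite: KnuthTAOCP2, §4.6.2, Algorithm B] [cite: LenstraLenstraLovasz1982, (3.1)] -/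
theorem berlekampFactor_spec {f : List ℤ} (hfn : Normal p f) (hfm : (toZMod p f).Monic)
    (hfd : (toZMod p f).natDegree = f.length - 1) (hf2 : 2 ≤ f.length) (hsqf : Squarefree (toZMod p f)) :
    Normal p (berlekampFactor p f) ∧ (toZMod p (berlekampFactor p f)).Monic ∧
      (toZMod p (berlekampFactor p f)).natDegree = (berlekampFactor p f).length - 1 ∧
      Irreducible (toZMod p (berlekampFactor p f)) ∧ toZMod p (berlekampFactor p f) ∣ toZMod p f ∧
      2 ≤ (berlekampFactor p f).length ∧ (berlekampFactor p f).length ≤ f.length := by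
  have hrun : berlekampFactor p f = berlRun p f f.length := rfl
  obtain ⟨⟨hn, hm, hd, h2, hlen, hdvd⟩, hor⟩ := berlRun_spec hsqf ⟨hfn, hfm, hfd, hf2, le_rfl, dvd_rfl⟩ f.length
  rw [← hrun] at hn hm hd h2 hlen hdvd hor
  have hfix : berlStep p (berlekampFactor p f) = berlekampFactor p f := by
    rcases hor with h | h
    · exact h
    · omega
  obtain ⟨-, -, hirr, -⟩ := berlStep_spec hsqf ⟨hn, hm, hd, h2, hlen, hdvd⟩
  exact ⟨hn, hm, hd, hirr hfix, hdvd, h2, hlen⟩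

end Spec

end LLLFactoring

end Literature.Computability.Complexity
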